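import Literature.NumberTheory.Automorphic.LocalUnitaryGroupCongr          -- ★ `cmDatumLocalCongr`, `toLocalGL`, `formCongr_map`, `cmDatum` (`toLocal`)
import Literature.NumberTheory.Automorphic.UnitaryGroupPureTensorContinuity -- ★ `localPiEquiv_evalPlace_finPart`, `finPart`, `evalPlace`
import HarnessLib

/-!
# The adelic congruence of unitary groups commutes with the LOCAL projections `g ↦ g_v`
# (Platonov–Rapinchuk 1994 §2.3, §5.1; Borel–Jacquet 1979 §4.1)

Topic `NumberTheory/Automorphic`; namespace `Literature.NumberTheory.Automorphic.UnitaryGroup`.  THEOREMS ONLY (no `def`, no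
`sorry`, no named fact); imports = tree.

**Setting.** `L` a CM field, `L⁺` its maximal real subfield, `c` complex conjugation, `H₀, H′ ∈ M_N(L)` and a RATIONAL change of
basis `Q ∈ GL_N(L)` with `ᵗ(cQ) · H₀ · Q = H′`.  The tree has the ADELIC congruence
★ `adelicUnitaryGroupCongr L Q H₀ H′ hQ : U(H′)(𝔸_{L⁺}) ≃ₜ* U(H₀)(𝔸_{L⁺})`, `x ↦ Q_𝔸 x Q_𝔸⁻¹`, its archimedean and
finite-adelic components (★ `archPart_adelicUnitaryGroupCongr`, ★ `finPart_adelicUnitaryGroupCongr` of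
`AdelicCongruenceArchFinCompat`), the finite-adelic ↔ place-`v` compatibility (★ `evalPlace_finAdelicCongr`, (P1) of
`UnitaryGroupLocalCongr`, in the restricted-product carrier `localPi`), and the LOCAL change of basis
★ `cmDatumLocalCongr L v T ha hT : U(H′)(L⁺_v) ≃ₜ* U(H₀)(L⁺_v)`, `g ↦ T g T⁻¹`, for a similitude `T ∈ GL_N(L ⊗ L⁺_v)` (carrier
`(cmDatum L N ·).Local v = UnitaryGroup.«local» … v ≤ GL_N(∏_{w ∣ v} L_w)`).

This file adds the missing row in the `toLocal` ∕ `cmDatumLocalCongr` currency of the singular-covolume letters: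

* §1 `map_adeleToLocal_toAdeleGL` — `(Q_𝔸)_v = Q_v`: the `v`-component of the diagonal image of `Q` is `toLocalGL L v Q`;
  `formCongr_toLocalGL_one_smul` — the rational congruence read over `L ⊗ L⁺_v`: `ᵗ((c ⊗ 1) Q_v) · (H₀)_v · Q_v = 1 • (H′)_v`,
  i.e. exactly the hypothesis ★ `cmDatumLocalCongr L v (toLocalGL L v Q) isUnit_one _` consumes;
* §2 **`toLocal_adelicUnitaryGroupCongr`** — `(Q_𝔸 g Q_𝔸⁻¹)_v = Q_v g_v Q_v⁻¹`:
  `(cmDatum L N H₀).toLocal v (adelicUnitaryGroupCongr L Q H₀ H′ hQ x) = cmDatumLocalCongr L v (toLocalGL L v Q) isUnit_one h₁ ((cmDatum L N H′).toLocal v x)`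
  (the local hypothesis `h₁` is kept as a binder, so any proof of it is accepted — e.g. §1's);
* §3 `localPiEquiv_evalPlace_finPart_adelicUnitaryGroupCongr` — the same read on the MODEL side
  (`localPi … v`, ★ `localPiEquiv_evalPlace_finPart`): `localPiEquiv (evalPlace v (Q_𝔸 x Q_𝔸⁻¹)_f) = Q_v x_v Q_v⁻¹`.

All proofs are entrywise (`(Q_𝔸)_{ij}` at a place `w ∣ v` is `Q_{ij} ∈ L ⊆ L_w`).

## References
* [PlatonovRapinchuk1994] V. Platonov, A. Rapinchuk, *Algebraic Groups and Number Theory* (1994), §2.3 (equivalent forms have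
  conjugate unitary groups), §5.1 (`G_{F_v}` of a matrix realisation; the local components of an adelic point).
* [BorelJacquet1979] A. Borel, H. Jacquet, *Automorphic forms and automorphic representations*, Proc. Symp. Pure Math. 33.1
  (1979), §4.1 (`G(𝔸) = G_∞ × G(𝔸_f)`, local components).
* [Rogawski1990] J. D. Rogawski, *Automorphic Representations of Unitary Groups in Three Variables* (1990), §14.5 p. 239 (the
  rational frame of a singular class, transported place by place).
-/

set_option autoImplicit false

noncomputable section

open NumberField IsDedekindDomain
open scoped Matrix MatrixGroups

namespace Literature.NumberTheory.Automorphic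

namespace UnitaryGroup

section CM

variable (L : Type) [Field L] [NumberField L] [IsCMField L] {N : ℕ}

/-! ## §1 The `v`-component of the diagonal image of `Q`, and the congruence read over `L ⊗ L⁺_v` -/

omit [IsCMField L] in
/-- **`(Q_𝔸)_v = Q_v`**: `GL_N` of the projection `𝔸_L → ∏_{w ∣ v} L_w` takes the diagonal image `toAdeleGL L Q` of `Q ∈ GL_N(L)` to
`toLocalGL L v Q` (entrywise ★ `adeleToLocal_comp_algebraMap`). [cite: PlatonovRapinchuk1994, §5.1] -/
theorem map_adeleToLocal_toAdeleGL (v : HeightOneSpectrum (𝓞 ↥(maximalRealSubfield L))) (Q : GL (Fin N) L) :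
    Matrix.GeneralLinearGroup.map (adeleToLocal L v) (toAdeleGL L Q) = toLocalGL L v Q := by
  refine Units.ext (Matrix.ext fun i j => ?_)
  change adeleToLocal L v (algebraMap L (AdeleRing (𝓞 L) L) ((Q : Matrix (Fin N) (Fin N) L) i j)) =
    algebraMap L (LocalRing L v) ((Q : Matrix (Fin N) (Fin N) L) i j)
  rw [← adeleToLocal_comp_algebraMap L v, RingHom.comp_apply]

/-- **The rational congruence read over `L ⊗ L⁺_v`**: `ᵗ(cQ) · H₀ · Q = H′` gives
`ᵗ((c ⊗ 1) Q_v) · (H₀ ⊗ 1) · Q_v = 1 • (H′ ⊗ 1)` — the similitude hypothesis of ★ `cmDatumLocalCongr L v (toLocalGL L v Q) isUnit_one`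
(★ `formCongr_map` along `L → L ⊗ L⁺_v`, which intertwines `c` and `c ⊗ 1` by ★ `algebraMap_localRing_conj`).
[cite: PlatonovRapinchuk1994, §2.3] -/
theorem formCongr_toLocalGL_one_smul {H₀ H' : Matrix (Fin N) (Fin N) L} (Q : GL (Fin N) L)
    (hQ : ((Q : Matrix (Fin N) (Fin N) L).map (cmConjRingHom L))ᵀ * H₀ * (Q : Matrix (Fin N) (Fin N) L) = H')
    (v : HeightOneSpectrum (𝓞 ↥(maximalRealSubfield L))) :
    formCongr (conjLocal L (IsCMField.complexConj L) v) (toLocalGL L v Q) (H₀.map (algebraMap L (LocalRing L v))) =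
      (1 : LocalRing L v) • H'.map (algebraMap L (LocalRing L v)) := by
  have hmap := formCongr_map ((IsCMField.complexConj L : L ≃ₐ[↥(maximalRealSubfield L)] L) : L →+* L)
    (algebraMap L (LocalRing L v)) (algebraMap_localRing_conj L (IsCMField.complexConj L) v) Q H₀
  rw [one_smul, ← hQ]
  exact hmap.symm

/-! ## §2 The adelic congruence commutes with `toLocal v` -/

variable {L}
variable {H₀ H' : Matrix (Fin N) (Fin N) L}

/-- **`(Q_𝔸 g Q_𝔸⁻¹)_v = Q_v g_v Q_v⁻¹`**: the local projection `toLocal v` of the CM datum intertwines the ADELIC congruence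
★ `adelicUnitaryGroupCongr L Q H₀ H′ hQ` with the LOCAL change of basis ★ `cmDatumLocalCongr L v (toLocalGL L v Q) isUnit_one h₁`
(`h₁` = §1 `formCongr_toLocalGL_one_smul`, kept as a binder so that any proof of it is accepted).
[cite: PlatonovRapinchuk1994, §2.3, §5.1] [cite: BorelJacquet1979, §4.1] -/
theorem toLocal_adelicUnitaryGroupCongr (Q : GL (Fin N) L)
    (hQ : ((Q : Matrix (Fin N) (Fin N) L).map (cmConjRingHom L))ᵀ * H₀ * (Q : Matrix (Fin N) (Fin N) L) = H')
    (v : HeightOneSpectrum (𝓞 ↥(maximalRealSubfield L)))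
    (h₁ : formCongr (conjLocal L (IsCMField.complexConj L) v) (toLocalGL L v Q) (H₀.map (algebraMap L (LocalRing L v))) =
      (1 : LocalRing L v) • H'.map (algebraMap L (LocalRing L v)))
    (g : (cmDatum L N H').Adelic) :
    (cmDatum L N H₀).toLocal v (adelicUnitaryGroupCongr L Q H₀ H' hQ g) =
      cmDatumLocalCongr L v (toLocalGL L v Q) isUnit_one h₁ ((cmDatum L N H').toLocal v g) := by
  refine Subtype.ext ?_
  rw [coe_cmDatumLocalCongr_apply, coe_cmDatum_toLocal, coe_cmDatum_toLocal, coe_adelicUnitaryGroupCongr, map_mul, map_mul,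
    map_inv, map_adeleToLocal_toAdeleGL]

/-- The same on underlying matrices of `GL_N(∏_{w ∣ v} L_w)`: `((Q_𝔸 x Q_𝔸⁻¹)_v : GL_N) = Q_v · x_v · Q_v⁻¹` — hypothesis-free
(no `h₁`). [cite: PlatonovRapinchuk1994, §2.3, §5.1] -/
theorem coe_toLocal_adelicUnitaryGroupCongr (Q : GL (Fin N) L)
    (hQ : ((Q : Matrix (Fin N) (Fin N) L).map (cmConjRingHom L))ᵀ * H₀ * (Q : Matrix (Fin N) (Fin N) L) = H')
    (v : HeightOneSpectrum (𝓞 ↥(maximalRealSubfield L))) (g : (cmDatum L N H').Adelic) :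
    (((cmDatum L N H₀).toLocal v (adelicUnitaryGroupCongr L Q H₀ H' hQ g)).val : GL (Fin N) (LocalRing L v)) =
      toLocalGL L v Q * ((cmDatum L N H').toLocal v g).val * (toLocalGL L v Q)⁻¹ := by
  rw [coe_cmDatum_toLocal, coe_cmDatum_toLocal, coe_adelicUnitaryGroupCongr, map_mul, map_mul, map_inv,
    map_adeleToLocal_toAdeleGL]

/-- **Corollary (images)**: `toLocal v` carries the image of a set `A ⊆ U(H′)(𝔸)` under the adelic congruence to the image of
`toLocal v (A)` under the local change of basis — e.g. centralisers of rational points and their levels, place by place.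
[cite: PlatonovRapinchuk1994, §2.3, §5.1] -/
theorem image_toLocal_image_adelicUnitaryGroupCongr (Q : GL (Fin N) L)
    (hQ : ((Q : Matrix (Fin N) (Fin N) L).map (cmConjRingHom L))ᵀ * H₀ * (Q : Matrix (Fin N) (Fin N) L) = H')
    (v : HeightOneSpectrum (𝓞 ↥(maximalRealSubfield L)))
    (h₁ : formCongr (conjLocal L (IsCMField.complexConj L) v) (toLocalGL L v Q) (H₀.map (algebraMap L (LocalRing L v))) =
      (1 : LocalRing L v) • H'.map (algebraMap L (LocalRing L v)))
    (A : Set (cmDatum L N H').Adelic) :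
    (cmDatum L N H₀).toLocal v '' (adelicUnitaryGroupCongr L Q H₀ H' hQ '' A) =
      cmDatumLocalCongr L v (toLocalGL L v Q) isUnit_one h₁ '' ((cmDatum L N H').toLocal v '' A) := by
  rw [Set.image_image, Set.image_image]
  exact Set.image_congr' fun g => toLocal_adelicUnitaryGroupCongr Q hQ v h₁ g

/-! ## §3 The model-side reading (`localPi … v`) -/

/-- **`localPiEquiv (evalPlace v (Q_𝔸 x Q_𝔸⁻¹)_f) = Q_v x_v Q_v⁻¹`**: the `v`-component of the finite part of the transported point, read
in `U(H₀)(L⁺_v) ≤ GL_N(∏_{w ∣ v} L_w)` through ★ `localPiEquiv`, is the local change of basis of `x_v` (★ `localPiEquiv_evalPlace_finPart`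
composed with §2). [cite: PlatonovRapinchuk1994, §5.1] [cite: BorelJacquet1979, §4.1] -/
theorem localPiEquiv_evalPlace_finPart_adelicUnitaryGroupCongr (Q : GL (Fin N) L)
    (hQ : ((Q : Matrix (Fin N) (Fin N) L).map (cmConjRingHom L))ᵀ * H₀ * (Q : Matrix (Fin N) (Fin N) L) = H')
    (v : HeightOneSpectrum (𝓞 ↥(maximalRealSubfield L)))
    (h₁ : formCongr (conjLocal L (IsCMField.complexConj L) v) (toLocalGL L v Q) (H₀.map (algebraMap L (LocalRing L v))) =
      (1 : LocalRing L v) • H'.map (algebraMap L (LocalRing L v)))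
    (g : (cmDatum L N H').Adelic) :
    localPiEquiv L (IsCMField.complexConj L) N H₀ v
        (evalPlace (↥(maximalRealSubfield L)) L (IsCMField.complexConj L) N H₀ v
          (finPart (↥(maximalRealSubfield L)) L (IsCMField.complexConj L) N H₀ (adelicUnitaryGroupCongr L Q H₀ H' hQ g))) =
      cmDatumLocalCongr L v (toLocalGL L v Q) isUnit_one h₁ ((cmDatum L N H').toLocal v g) := by
  rw [localPiEquiv_evalPlace_finPart, ← toLocal_adelicUnitaryGroupCongr Q hQ v h₁ g]
  rfl

end CM

end UnitaryGroup

end Literature.NumberTheory.Automorphic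

end
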